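import Summits.CriticalPhenomena.PercolationContinuityZ3.Theorems.PercNearOneGluingNoHeavyLowerTailFrontierDecRowsUnmarkedEdgeKey
import Summits.CriticalPhenomena.PercolationContinuityZ3.Theorems.PercNearOneGluingNoHeavyLowerTailIncStarOfRootUnmarked
import HarnessLib

/-!
# The KEY forms of an edge step, II: the one-bond expansion `E₃(w) = (1−p)·E₃(w⁰) + p²·E₃(w¹) + p(1−p)·K + p²(1−p)·π_Aπ_Bπ_C`,
# the DELETION / CONTRACTION bounds, and the open-end KEY for INCREASING rows (the increasing star from ONE five-point inequality)

Support file (prover seat `prim-bnk-1`, gen 9; `--supports stmt-CriticalPhenomena-4575`).  No named facts, no sorries, no `native_decide`;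
one bookkeeping definition (`KeyOpenHypAt i₀`, the open-end twin of `KeyHypAt`).  Sequel of `…FrontierDecRowsUnmarkedEdgeKey`.

For a Bernstein cubic `T(p)` of Sahi's `E₃(A,B,C)` along an edge `e` of weight `p = w e` (`B₀ = E₃(μ⁰)`, `B₁ = polar₁ μ⁰ μ¹`, `B₂ = polar₁ μ¹ μ⁰`,
`B₃ = E₃(μ¹)`; `μ⁰, μ¹` the laws with `e` closed / open) the KEY form of `…UnmarkedEdgeKey` is `K = 3B₁ − 2B₀ = T(0) + T'(0) = key μ⁰ μ¹`.
**One-bond KEY expansion** (`sahiE3_oneBond_key`; from `EdgeInduction.sahiE3_oneBond` and the two identities of part I):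
  `T(p) = (1−p)·T(0) + p²·T(1) + p(1−p)·K + p²(1−p)·π_A π_B π_C`,   `π_E = μ⁰(E) − μ¹(E)`,
so for DECREASING events (`π ≥ 0`) `K ≥ 0` and `T(1) ≥ 0` give the **DELETION BOUND** `E₃(w) ≥ (1 − w e)·E₃(w[e↦0])`
(`sahiE3_ge_deletion_of_key`) — and conversely `K = lim_{p→0} (T(p) − (1−p)T(0))/p`, so `K ≥ 0` IS the deletion bound to first order:
"deleting a (terminal, unmarked) edge of weight `p` divides `E₃` by at most `1 − p`".  Mirror image at the open end (`sahiE3_oneBond_keyOpen`):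
  `T(p) = p·T(1) + (1−p)²·T(0) + p(1−p)·K' + p(1−p)²·Π_E (μ¹(E) − μ⁰(E))`,   `K' := 3B₂ − 2B₃ = T(1) − T'(1) = key μ¹ μ⁰ A B C`,
so for INCREASING events (`μ¹(E) ≥ μ⁰(E)`, tree lemma `tieLiftOne_real_zero_le_one`) `K' ≥ 0` and `T(0) ≥ 0` give the **CONTRACTION BOUND**
`E₃(w) ≥ (w e)·E₃(w[e↦1])` (`sahiE3_ge_contraction_of_keyOpen`), and `K' ≥ 0` (given `B₀, B₃ ≥ 0`) implies `B₁, B₂ ≥ 0` for upper-set families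
(`B₂ = ⅔·B₃ + ⅓·K'`, `3·B₁ = B₀ + B₃ + K' + Π(μ¹ − μ⁰)`; `unmarkedEdgeHypAt_of_keyOpenHypAt`) — the open-end KEY is the form to use for increasing rows.
Application to prim-sahi-p2's increasing star (`IncStar.incStar_nonneg_of_rootUnmarkedBernstein`, p217195: the star `E₃({s↔b},{s↔c},{s↔y}) ≥ 0`
on every finite weighted graph from `B₁, B₂ ≥ 0` at the ROOT–UNMARKED edges): **`IncStar.incStar_nonneg_of_rootUnmarkedKey`** — the increasing star
for all graphs on `Fin n` from ONE cubic inequality `K' = key μ¹ μ⁰ ≥ 0` per root–unmarked edge `s — z` (given the IH rows), a cubic form in the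
52-cell five-point law of `(s,b,c,y,z)`.  Numerics (this seat, work/numerics/key_check.py: exact enumeration, random weighted graphs `n ≤ 7`):
increasing star `K' ≥ 0` in all root–unmarked instances (and `K ≥ 0` too), `K' = 0` attained; decreasing rows 44 / 36: `K ≥ 0` throughout
(row 44: also `K' ≥ 0`; PATH: `K' < 0` occurs).
-/

noncomputable section

namespace Summit.CriticalPhenomena.PercolationContinuityZ3.Theorems

namespace TerminalEdgeInduction

open MeasureTheory Literature.Probability.Percolation Literature.Probability.LatticeModels
open EdgeInduction CovTransferCert E3GroupSepCert
open scoped Classical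

variable {n k : ℕ}

/-! ### Monotonicity for increasing events: the pivotal product -/

/-- The pivotal product `(μ¹A − μ⁰A)(μ¹B − μ⁰B)(μ¹C − μ⁰C) ≥ 0` for three increasing events (monotonicity
`μ_{w[e↦0]}(S) ≤ μ_{w[e↦1]}(S)` for increasing `S` is the tree lemma `tieLiftOne_real_zero_le_one`). [this work] -/
theorem pivotal_prod_nonneg_upper (w : Sym2 (Fin n) → unitInterval) (e : Sym2 (Fin n)) {A B C : Set (BondConfig (Fin n))}
    (hA : IsUpperSet A) (hB : IsUpperSet B) (hC : IsUpperSet C) :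
    0 ≤ ((prodBernoulli (Function.update w e 1)).real A - (prodBernoulli (Function.update w e 0)).real A)
        * ((prodBernoulli (Function.update w e 1)).real B - (prodBernoulli (Function.update w e 0)).real B)
        * ((prodBernoulli (Function.update w e 1)).real C - (prodBernoulli (Function.update w e 0)).real C) :=
  mul_nonneg (mul_nonneg (sub_nonneg.2 (tieLiftOne_real_zero_le_one w e hA))
    (sub_nonneg.2 (tieLiftOne_real_zero_le_one w e hB))) (sub_nonneg.2 (tieLiftOne_real_zero_le_one w e hC))

/-! ### The one-bond KEY expansions and the deletion / contraction bounds -/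

/-- **One-bond KEY expansion (closed end).**  With `p = w e`, `μ⁰ = μ_{w[e↦0]}`, `μ¹ = μ_{w[e↦1]}`:
`E₃(w) = (1−p)·E₃(μ⁰) + p²·E₃(μ¹) + p(1−p)·key μ⁰ μ¹ + p²(1−p)·π_A π_B π_C`, `π_E = μ⁰(E) − μ¹(E)`. [this work] -/
theorem sahiE3_oneBond_key (w : Sym2 (Fin n) → unitInterval) (e : Sym2 (Fin n)) (A B C : Set (BondConfig (Fin n))) :
    sahiE3 (prodBernoulli w) A B C =
      (1 - (w e : ℝ)) * sahiE3 (prodBernoulli (Function.update w e 0)) A B C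
      + (w e : ℝ) ^ 2 * sahiE3 (prodBernoulli (Function.update w e 1)) A B C
      + (w e : ℝ) * (1 - (w e : ℝ))
          * key (prodBernoulli (Function.update w e 0)) (prodBernoulli (Function.update w e 1)) A B C
      + (w e : ℝ) ^ 2 * (1 - (w e : ℝ))
          * (((prodBernoulli (Function.update w e 0)).real A - (prodBernoulli (Function.update w e 1)).real A)
            * ((prodBernoulli (Function.update w e 0)).real B - (prodBernoulli (Function.update w e 1)).real B)
            * ((prodBernoulli (Function.update w e 0)).real C - (prodBernoulli (Function.update w e 1)).real C)) := by
  have h := three_mul_polar₁_swap (prodBernoulli (Function.update w e 0)) (prodBernoulli (Function.update w e 1)) A B C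
  rw [sahiE3_oneBond w e A B C, polar₁_eq_key]
  linear_combination ((w e : ℝ) ^ 2 * (1 - (w e : ℝ))) * h

/-- **One-bond KEY expansion (open end).**  With `K' = key μ¹ μ⁰`:
`E₃(w) = p·E₃(μ¹) + (1−p)²·E₃(μ⁰) + p(1−p)·K' + p(1−p)²·Π_E (μ¹(E) − μ⁰(E))`. [this work] -/
theorem sahiE3_oneBond_keyOpen (w : Sym2 (Fin n) → unitInterval) (e : Sym2 (Fin n)) (A B C : Set (BondConfig (Fin n))) :
    sahiE3 (prodBernoulli w) A B C =
      (w e : ℝ) * sahiE3 (prodBernoulli (Function.update w e 1)) A B C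
      + (1 - (w e : ℝ)) ^ 2 * sahiE3 (prodBernoulli (Function.update w e 0)) A B C
      + (w e : ℝ) * (1 - (w e : ℝ))
          * key (prodBernoulli (Function.update w e 1)) (prodBernoulli (Function.update w e 0)) A B C
      + (w e : ℝ) * (1 - (w e : ℝ)) ^ 2
          * (((prodBernoulli (Function.update w e 1)).real A - (prodBernoulli (Function.update w e 0)).real A)
            * ((prodBernoulli (Function.update w e 1)).real B - (prodBernoulli (Function.update w e 0)).real B)
            * ((prodBernoulli (Function.update w e 1)).real C - (prodBernoulli (Function.update w e 0)).real C)) := by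
  have h := three_mul_polar₁_swap (prodBernoulli (Function.update w e 1)) (prodBernoulli (Function.update w e 0)) A B C
  rw [sahiE3_oneBond w e A B C, polar₁_eq_key (prodBernoulli (Function.update w e 1))]
  linear_combination ((w e : ℝ) * (1 - (w e : ℝ)) ^ 2) * h

/-- **DELETION BOUND.**  For decreasing `A, B, C`: if `K = key μ⁰ μ¹ ≥ 0` and `E₃(μ¹) ≥ 0` then `(1 − w e)·E₃(w[e↦0]) ≤ E₃(w)` —
deleting the edge divides `E₃` by at most `1 − w e`. [this work] -/
theorem sahiE3_ge_deletion_of_key (w : Sym2 (Fin n) → unitInterval) (e : Sym2 (Fin n)) {A B C : Set (BondConfig (Fin n))}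
    (hA : IsLowerSet A) (hB : IsLowerSet B) (hC : IsLowerSet C)
    (hK : 0 ≤ key (prodBernoulli (Function.update w e 0)) (prodBernoulli (Function.update w e 1)) A B C)
    (h1 : 0 ≤ sahiE3 (prodBernoulli (Function.update w e 1)) A B C) :
    (1 - (w e : ℝ)) * sahiE3 (prodBernoulli (Function.update w e 0)) A B C ≤ sahiE3 (prodBernoulli w) A B C := by
  have hp0 : (0 : ℝ) ≤ w e := (w e).2.1
  have hp1 : (w e : ℝ) ≤ 1 := (w e).2.2
  have hq : (0 : ℝ) ≤ 1 - w e := sub_nonneg.2 hp1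
  have hπ := pivotal_prod_nonneg w e hA hB hC
  rw [sahiE3_oneBond_key w e A B C]
  have h2 : 0 ≤ (w e : ℝ) ^ 2 * sahiE3 (prodBernoulli (Function.update w e 1)) A B C := by positivity
  have h3 : 0 ≤ (w e : ℝ) * (1 - (w e : ℝ))
      * key (prodBernoulli (Function.update w e 0)) (prodBernoulli (Function.update w e 1)) A B C :=
    mul_nonneg (mul_nonneg hp0 hq) hK
  have h4 : 0 ≤ (w e : ℝ) ^ 2 * (1 - (w e : ℝ))
      * (((prodBernoulli (Function.update w e 0)).real A - (prodBernoulli (Function.update w e 1)).real A)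
        * ((prodBernoulli (Function.update w e 0)).real B - (prodBernoulli (Function.update w e 1)).real B)
        * ((prodBernoulli (Function.update w e 0)).real C - (prodBernoulli (Function.update w e 1)).real C)) :=
    mul_nonneg (mul_nonneg (pow_nonneg hp0 2) hq) hπ
  linarith

/-- **CONTRACTION BOUND.**  For increasing `A, B, C`: if `K' = key μ¹ μ⁰ ≥ 0` and `E₃(μ⁰) ≥ 0` then `(w e)·E₃(w[e↦1]) ≤ E₃(w)` —
contracting the edge divides `E₃` by at most `w e`. [this work] -/
theorem sahiE3_ge_contraction_of_keyOpen (w : Sym2 (Fin n) → unitInterval) (e : Sym2 (Fin n)) {A B C : Set (BondConfig (Fin n))}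
    (hA : IsUpperSet A) (hB : IsUpperSet B) (hC : IsUpperSet C)
    (hK : 0 ≤ key (prodBernoulli (Function.update w e 1)) (prodBernoulli (Function.update w e 0)) A B C)
    (h0 : 0 ≤ sahiE3 (prodBernoulli (Function.update w e 0)) A B C) :
    (w e : ℝ) * sahiE3 (prodBernoulli (Function.update w e 1)) A B C ≤ sahiE3 (prodBernoulli w) A B C := by
  have hp0 : (0 : ℝ) ≤ w e := (w e).2.1
  have hp1 : (w e : ℝ) ≤ 1 := (w e).2.2
  have hq : (0 : ℝ) ≤ 1 - w e := sub_nonneg.2 hp1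
  have hπ := pivotal_prod_nonneg_upper w e hA hB hC
  rw [sahiE3_oneBond_keyOpen w e A B C]
  have h2 : 0 ≤ (1 - (w e : ℝ)) ^ 2 * sahiE3 (prodBernoulli (Function.update w e 0)) A B C := by positivity
  have h3 : 0 ≤ (w e : ℝ) * (1 - (w e : ℝ))
      * key (prodBernoulli (Function.update w e 1)) (prodBernoulli (Function.update w e 0)) A B C :=
    mul_nonneg (mul_nonneg hp0 hq) hK
  have h4 : 0 ≤ (w e : ℝ) * (1 - (w e : ℝ)) ^ 2
      * (((prodBernoulli (Function.update w e 1)).real A - (prodBernoulli (Function.update w e 0)).real A)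
        * ((prodBernoulli (Function.update w e 1)).real B - (prodBernoulli (Function.update w e 0)).real B)
        * ((prodBernoulli (Function.update w e 1)).real C - (prodBernoulli (Function.update w e 0)).real C)) :=
    mul_nonneg (mul_nonneg hp0 (pow_nonneg hq 2)) hπ
  linarith

/-! ### The open-end reduction -/

/-- `B₁ ≥ 0` from `B₀, B₃ ≥ 0`, the open-end KEY `key ν μ ≥ 0` and `(νA − μA)(νB − μB)(νC − μC) ≥ 0`. [this work] -/
theorem polar₁_nonneg_of_key_open {μ ν : Measure (BondConfig (Fin n))} {A B C : Set (BondConfig (Fin n))}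
    (h0 : 0 ≤ sahiE3 μ A B C) (h1 : 0 ≤ sahiE3 ν A B C) (hK : 0 ≤ key ν μ A B C)
    (hπ : 0 ≤ (ν.real A - μ.real A) * (ν.real B - μ.real B) * (ν.real C - μ.real C)) :
    0 ≤ polar₁ μ ν A B C := by
  have h := three_mul_polar₁_swap ν μ A B C
  linarith

/-- `B₂ ≥ 0` from `B₃ ≥ 0` and the open-end KEY (this is `polar₁_nonneg_of_key` with the laws exchanged). [this work] -/
theorem polar₁_swap_nonneg_of_key_open {μ ν : Measure (BondConfig (Fin n))} {A B C : Set (BondConfig (Fin n))}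
    (h1 : 0 ≤ sahiE3 ν A B C) (hK : 0 ≤ key ν μ A B C) : 0 ≤ polar₁ ν μ A B C :=
  polar₁_nonneg_of_key h1 hK

/-- **The open-end KEY hypotheses at the terminal `i₀`**: as `KeyHypAt`, with the conclusion `0 ≤ key μ_{w[e↦1]} μ_{w[e↦0]} (E₁ x) (E₂ x) (E₃ x)`
(`K' = 3B₂ − 2B₃ = T(1) − T'(1)`; the form to use for increasing families). [this work] -/
def KeyOpenHypAt (i₀ : Fin k) (E₁ E₂ E₃ : (Fin k → Fin n) → Set (BondConfig (Fin n))) : Prop :=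
  ∀ (w : Sym2 (Fin n) → unitInterval) (x : Fin k → Fin n), Function.Injective x → ∀ (u : Fin n), (∀ j, x j ≠ u) →
    0 ≤ sahiE3 (prodBernoulli (Function.update w s(x i₀, u) 0)) (E₁ x) (E₂ x) (E₃ x) →
    0 ≤ sahiE3 (prodBernoulli (Function.update w s(x i₀, u) 1)) (E₁ x) (E₂ x) (E₃ x) →
    0 ≤ key (prodBernoulli (Function.update w s(x i₀, u) 1)) (prodBernoulli (Function.update w s(x i₀, u) 0))
        (E₁ x) (E₂ x) (E₃ x)

variable {E₁ E₂ E₃ : (Fin k → Fin n) → Set (BondConfig (Fin n))}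

/-- **Open-end KEY ⇒ both unmarked-edge hypotheses**, for families of increasing events (so the row-agnostic unmarked-edge schema
`sahiE3_pev_nonneg_of_unmarkedEdgeHyp` runs on ONE cubic inequality per (row, terminal) for increasing pattern rows too). [this work] -/
theorem unmarkedEdgeHypAt_of_keyOpenHypAt {i₀ : Fin k} (hE₁ : ∀ x, IsUpperSet (E₁ x)) (hE₂ : ∀ x, IsUpperSet (E₂ x))
    (hE₃ : ∀ x, IsUpperSet (E₃ x)) (h : KeyOpenHypAt i₀ E₁ E₂ E₃) : UnmarkedEdgeHypAt i₀ E₁ E₂ E₃ := by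
  intro w x hx u hu h0 h1
  have hK := h w x hx u hu h0 h1
  exact ⟨polar₁_nonneg_of_key_open h0 h1 hK (pivotal_prod_nonneg_upper w s(x i₀, u) (hE₁ x) (hE₂ x) (hE₃ x)),
    polar₁_swap_nonneg_of_key_open h1 hK⟩

end TerminalEdgeInduction

namespace IncStar

open MeasureTheory Literature.Probability.Percolation Literature.Probability.LatticeModels
open EdgeInduction TerminalEdgeInduction
open scoped Classical

variable {n : ℕ}

/-- **The increasing star from ONE cubic inequality per root–unmarked edge.**  If for every weight `w`, all `s b c y` and every
`z ∉ {s,b,c,y}` the open-end KEY form `K' = key μ_{w[sz↦1]} μ_{w[sz↦0]}` of `({s↔b},{s↔c},{s↔y})` is nonnegative whenever the star holds under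
`μ_{w[sz↦0]}` and `μ_{w[sz↦1]}` (the induction hypotheses), then `E₃({s↔b},{s↔c},{s↔y}) ≥ 0` on every finite weighted graph on `Fin n`
(via prim-sahi-p2's `incStar_nonneg_of_rootUnmarkedBernstein`: `B₂ = ⅔B₃ + ⅓K'`, `3B₁ = B₀ + B₃ + K' + Π(μ¹ − μ⁰) ≥ 0`). [this work] -/
theorem incStar_nonneg_of_rootUnmarkedKey
    (hK : ∀ (w : Sym2 (Fin n) → unitInterval) (s b c y z : Fin n), z ≠ s → z ≠ b → z ≠ c → z ≠ y →
      0 ≤ sahiE3 (prodBernoulli (Function.update w s(s, z) 0)) (openConn s b) (openConn s c) (openConn s y) →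
      0 ≤ sahiE3 (prodBernoulli (Function.update w s(s, z) 1)) (openConn s b) (openConn s c) (openConn s y) →
      0 ≤ key (prodBernoulli (Function.update w s(s, z) 1)) (prodBernoulli (Function.update w s(s, z) 0))
            (openConn s b) (openConn s c) (openConn s y)) :
    ∀ (w : Sym2 (Fin n) → unitInterval) (s b c y : Fin n),
      0 ≤ sahiE3 (prodBernoulli w) (openConn s b) (openConn s c) (openConn s y) := by
  refine incStar_nonneg_of_rootUnmarkedBernstein ?_
  intro w s b c y z hzs hzb hzc hzy h0 h1
  have hk := hK w s b c y z hzs hzb hzc hzy h0 h1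
  exact ⟨polar₁_nonneg_of_key_open h0 h1 hk
      (pivotal_prod_nonneg_upper w s(s, z) (isUpperSet_openConn s b) (isUpperSet_openConn s c) (isUpperSet_openConn s y)),
    polar₁_swap_nonneg_of_key_open h1 hk⟩

end IncStar

end Summit.CriticalPhenomena.PercolationContinuityZ3.Theorems
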